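import Mathlib.Analysis.InnerProductSpace.PiL2
import HarnessLib

/-!
# Linear relations of zeta zeros: `{N_γ}`-independence, the lattice `L(K; S)` and the short-vector lemmas (Best–Trudgian 2015, §2 Def. 1, §3 Defs. 2–4, Lemmas 1–2)

Topic `Literature/NumberTheory/LFunctions` (sub-namespace `BestTrudgian`, naming the paper). This
file vendors — with complete proofs — the *combinatorial / lattice* half of

* D. G. Best, T. S. Trudgian, *Linear relations of zeroes of the zeta-function*, Math. Comp. 84
  (2015), 2047–2058; arXiv:1209.3843 [BestTrudgian2015],

namely the weakened linear-independence notion of Anderson–Stark used in Grosswald's approach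
(§2, Definition 1: "the elements of `Γ'` are `{N_γ}`-independent in `Γ ∩ [0, T]`"), the lattice
`L(K; S)` (§3.1, Definition 2), `N_γ`-dependence and weak `N_γ`-dependence (Definitions 3–4) and
the two short-vector lemmas (Lemmas 1–2). The Gram–Schmidt bound (Lemma 3) and their combination,
Theorem 3 (Gram–Schmidt lengths of some basis of `L(K; Γ')` and of each `L(K; Γ' ∪ {γ_t})` certify
`{N_γ}`-independence), are proved in `ZetaZeroLinearRelationsCertificate.lean`. "Although we will
be directing our attention at zeroes, all of these processes work with any set of real numbers"
(§3, p. 5): nothing here mentions `ζ`; the application to the ordinates of the zeros (Theorem 4, an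
LLL computation with the first 2000 zeros to 9000 digits, and Theorem 1,
`limsup M(x)x^{-1/2} ≥ 1.6383`) is recorded as named facts in `BestTrudgian2015.lean`.

## Main definitions and results (all proved)

* `BestTrudgian.NIndependent Γ T Γ' N` — Definition 1, (2.4)–(2.5).
* `BestTrudgian.latticeVec K γ a`, `BestTrudgian.lattice K γ` — Definition 2: the vector
  `(a₁, …, aₙ, Σ aᵢ ⌊Kγᵢ⌋)` and the lattice `L(K; S)` of all of them (`= ℤ`-span of the printed
  generators `(eᵢ, Kγᵢ')`, `Kγᵢ' = ⌊Kγᵢ⌋`), realised inside `ℝⁿ⁺¹ = EuclideanSpace ℝ (Fin (n+1))`.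
* `BestTrudgian.NDependent`, `BestTrudgian.WeaklyNDependent` — Definitions 3–4.
* `BestTrudgian.norm_sq_latticeVec_lt` — the common core of Lemmas 1–2: a relation vector has
  `‖v‖² < Σ aᵢ² + (Σ |aᵢ|)²`.
* `BestTrudgian.exists_short_of_weaklyNDependent` — Lemma 1 (bound `(n²+n)N² + (2n+2)N + 2`).
* `BestTrudgian.exists_short_of_relation` — Lemma 2 in the form used by Theorem 3 (bound
  `(n²+n)N² + 2nN + 2`), see "Deviations" below.

## Deviations from the printed text (documented, not silent)

* Definitions 3–4 print "`α₁, …, αₙ ∈ ℝ`"; the proofs of Lemmas 1–2 place `(α₁, …, αₙ, ·)` in the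
  integer lattice `L(K; S) ⊂ ℤⁿ⁺¹`, so the coefficients are integers, as in (1.1) and Definition 1.
  We take `αᵢ ∈ ℤ`.
* Lemma 2 is printed for an arbitrary `N_γ`-dependent set `{γ₁, …, γₙ, γ_t}` (all `|αᵢ| ≤ N_γ`), but
  its one-line proof ("follows that of Lemma 1; for each `i`, we have `|αᵢ| ≤ N_γ`") yields the
  printed bound `(n²+n)N² + 2nN + 2` only when the coefficient of `γ_t` is `∓1` — which is exactly
  the shape of condition (2.5) (`Σ_{γ ∈ Γ'} c_γ γ = γ*`) for which Theorem 3 invokes it. (With `n+1`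
  coefficients of size `N` the same argument gives only `(n²+3n+2)N²`, and for `n = 2`, `N ≥ 11` the
  relation `Nγ₁ + Nγ₂ = (N−1)γ_t` with `⌊Kγᵢ⌋`-defects near `1` produces a relation vector of squared
  length `7N² − 6N + 2 >` the printed bound.) We vendor the form that is used; Theorem 3 and hence
  Theorem 4 are unaffected.

## What is NOT here

Lemma 3 and Theorem 3 (`ZetaZeroLinearRelationsCertificate.lean`); the LLL algorithm and its
guarantee `|b_p*|² ≥ (δ − ¼)|b_{p−1}*|²` (only motivation in the source); the computation of
Theorem 4 (`k = 9000`, `n = 500`, `T = γ₂₀₀₁ − ε`, `N_γ = 4976`) and the oscillation theorem of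
Anderson–Stark (Theorem 2) — see `BestTrudgian2015.lean`.

## References

* [BestTrudgian2015] §2 (Definition 1, (2.4)–(2.5)), §3.1 (Definitions 2–4, Lemmas 1–2), read
  from arXiv:1209.3843.
* R. J. Anderson, H. M. Stark, *Oscillation theorems*, LNM 899 (1981) 79–106 (origin of
  Definition 1; cited through [BestTrudgian2015]).
-/

noncomputable section

open Finset

namespace Literature.NumberTheory.LFunctions

namespace BestTrudgian

/-! ## Definition 1: `{N_γ}`-independence -/

/-- **Best–Trudgian 2015, Definition 1** (after Anderson–Stark). Let `T > 0`, `Γ` a set of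
positive numbers, `Γ'` a finite subset of `Γ ∩ (0, T)` and `N_γ` positive integers (`γ ∈ Γ'`). The
elements of `Γ'` are *`{N_γ}`-independent in `Γ ∩ [0, T]`* if (2.4) `Σ_{γ ∈ Γ'} c_γ γ = 0` with
integers `|c_γ| ≤ N_γ` implies that all `c_γ = 0`, and (2.5) for any `γ* ∈ Γ ∩ [0, T]`,
`Σ_{γ ∈ Γ'} c_γ γ = γ*` with `|c_γ| ≤ N_γ` implies that `γ* ∈ Γ'`, that `c_{γ*} = 1`, and that all
other `c_γ = 0`. The side conditions (`Γ' ⊆ Γ ∩ (0,T)`, `N_γ ≥ 1`) are hypotheses where the notion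
is used, not part of the predicate; coefficients are functions `c : ℝ → ℤ` read on `Γ'`.
[cite: BestTrudgian2015, Definition 1] -/
def NIndependent (Γ : Set ℝ) (T : ℝ) (Γ' : Finset ℝ) (N : ℝ → ℕ) : Prop :=
  (∀ c : ℝ → ℤ, (∀ γ ∈ Γ', |c γ| ≤ N γ) → ∑ γ ∈ Γ', (c γ : ℝ) * γ = 0 → ∀ γ ∈ Γ', c γ = 0) ∧
  (∀ γs ∈ Γ ∩ Set.Icc 0 T, ∀ c : ℝ → ℤ, (∀ γ ∈ Γ', |c γ| ≤ N γ) →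
      ∑ γ ∈ Γ', (c γ : ℝ) * γ = γs → γs ∈ Γ' ∧ c γs = 1 ∧ ∀ γ ∈ Γ', γ ≠ γs → c γ = 0)

/-- (2.4) alone: `{N_γ}`-independence forbids non-trivial relations with `|c_γ| ≤ N_γ`.
[cite: BestTrudgian2015, Definition 1 (2.4)] -/
theorem NIndependent.eq_zero {Γ : Set ℝ} {T : ℝ} {Γ' : Finset ℝ} {N : ℝ → ℕ}
    (h : NIndependent Γ T Γ' N) {c : ℝ → ℤ} (hc : ∀ γ ∈ Γ', |c γ| ≤ N γ)
    (hsum : ∑ γ ∈ Γ', (c γ : ℝ) * γ = 0) : ∀ γ ∈ Γ', c γ = 0 :=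
  h.1 c hc hsum

/-! ## Definition 2: the lattice `L(K; S)` -/

variable {n : ℕ}

/-- The typical vector of `L(K; S)`, `S = {γ₁, …, γₙ}` (§3.1, display after Definition 2):
`a₁ (1, 0, …, 0, Kγ₁') + ⋯ + aₙ (0, …, 0, 1, Kγₙ') = (a₁, …, aₙ, Kx)`, `Kγᵢ' = ⌊Kγᵢ⌋`,
`Kx = Σ aᵢ ⌊Kγᵢ⌋`, as a point of `ℝⁿ⁺¹`. [cite: BestTrudgian2015, Definition 2] -/
def latticeVec (K : ℤ) (γ : Fin n → ℝ) (a : Fin n → ℤ) : EuclideanSpace ℝ (Fin (n + 1)) :=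
  WithLp.toLp 2 (Fin.snoc (fun i ↦ (a i : ℝ)) (∑ i, (a i : ℝ) * (⌊(K : ℝ) * γ i⌋ : ℝ)))

/-- **Best–Trudgian 2015, Definition 2.** `L(K; S) ⊂ ℤⁿ⁺¹`, the lattice generated by the vectors
`(eᵢ, Kγᵢ')`, `Kγᵢ' = ⌊Kγᵢ⌋` (`i = 1, …, n`), realised in `ℝⁿ⁺¹` as the `ℤ`-span of all the vectors
`latticeVec K γ a = Σ aᵢ (eᵢ, ⌊Kγᵢ⌋)`. [cite: BestTrudgian2015, Definition 2] -/
def lattice (K : ℤ) (γ : Fin n → ℝ) : Submodule ℤ (EuclideanSpace ℝ (Fin (n + 1))) :=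
  Submodule.span ℤ (Set.range (latticeVec K γ))

/-- Every `(a, Σ aᵢ⌊Kγᵢ⌋)` lies in `L(K; S)`. [cite: BestTrudgian2015, Definition 2] -/
theorem latticeVec_mem (K : ℤ) (γ : Fin n → ℝ) (a : Fin n → ℤ) :
    latticeVec K γ a ∈ lattice K γ :=
  Submodule.subset_span ⟨a, rfl⟩

/-- The first `n` coordinates of `latticeVec K γ a` are the `aᵢ`. [cite: BestTrudgian2015, Definition 2] -/
@[simp] theorem latticeVec_apply_castSucc (K : ℤ) (γ : Fin n → ℝ) (a : Fin n → ℤ) (i : Fin n) :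
    latticeVec K γ a i.castSucc = a i := by
  simp [latticeVec]

/-- The last coordinate of `latticeVec K γ a` is `Σ aᵢ ⌊Kγᵢ⌋`. [cite: BestTrudgian2015, Definition 2] -/
@[simp] theorem latticeVec_apply_last (K : ℤ) (γ : Fin n → ℝ) (a : Fin n → ℤ) :
    latticeVec K γ a (Fin.last n) = ∑ i, (a i : ℝ) * (⌊(K : ℝ) * γ i⌋ : ℝ) := by
  simp [latticeVec]

/-- `|v|² = a₁² + ⋯ + aₙ² + K²(a₁γ₁' + ⋯ + aₙγₙ')²` (proof of Lemma 1, first display).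
[cite: BestTrudgian2015, Lemma 1 (proof)] -/
theorem norm_sq_latticeVec (K : ℤ) (γ : Fin n → ℝ) (a : Fin n → ℤ) :
    ‖latticeVec K γ a‖ ^ 2 =
      ∑ i, (a i : ℝ) ^ 2 + (∑ i, (a i : ℝ) * (⌊(K : ℝ) * γ i⌋ : ℝ)) ^ 2 := by
  rw [EuclideanSpace.real_norm_sq_eq, Fin.sum_univ_castSucc]
  simp

/-- A non-zero coefficient vector gives a non-zero lattice vector. [cite: BestTrudgian2015, Definition 2] -/
theorem latticeVec_ne_zero (K : ℤ) (γ : Fin n → ℝ) {a : Fin n → ℤ} (ha : a ≠ 0) :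
    latticeVec K γ a ≠ 0 := by
  obtain ⟨i, hi⟩ := Function.ne_iff.mp ha
  intro h
  have h' := congrArg (fun v : EuclideanSpace ℝ (Fin (n + 1)) ↦ v i.castSucc) h
  simp only [latticeVec_apply_castSucc, PiLp.zero_apply, Int.cast_eq_zero] at h'
  exact hi h'

/-! ## Definitions 3–4: `N_γ`-dependence and weak `N_γ`-dependence -/

/-- **Best–Trudgian 2015, Definition 3.** `S = {γ₁, …, γₙ}` is *`N_γ`-dependent* if there are
integers `α₁, …, αₙ`, not all zero, with `α₁γ₁ + ⋯ + αₙγₙ = 0` and `|αᵢ| ≤ N_γ` (the source prints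
`αᵢ ∈ ℝ`; see the module docstring); *`N_γ`-independent* otherwise. [cite: BestTrudgian2015, Definition 3] -/
def NDependent (N : ℕ) (γ : Fin n → ℝ) : Prop :=
  ∃ α : Fin n → ℤ, α ≠ 0 ∧ ∑ i, (α i : ℝ) * γ i = 0 ∧ ∀ i, |α i| ≤ N

/-- **Best–Trudgian 2015, Definition 4.** `S` is *weakly `N_γ`-dependent* if there are integers
`α₁, …, αₙ`, not all zero, with `Σ αᵢγᵢ = 0`, `|αᵢ| ≤ N_γ + 1`, and at most one `i` with
`|αᵢ| = N_γ + 1`. [cite: BestTrudgian2015, Definition 4] -/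
def WeaklyNDependent (N : ℕ) (γ : Fin n → ℝ) : Prop :=
  ∃ α : Fin n → ℤ, α ≠ 0 ∧ ∑ i, (α i : ℝ) * γ i = 0 ∧ (∀ i, |α i| ≤ N + 1) ∧
    ∀ i j, |α i| = N + 1 → |α j| = N + 1 → i = j

/-- `N_γ`-dependent sets are weakly `N_γ`-dependent. [cite: BestTrudgian2015, Definitions 3–4] -/
theorem NDependent.weaklyNDependent {N : ℕ} {γ : Fin n → ℝ} (h : NDependent N γ) :
    WeaklyNDependent N γ := by
  obtain ⟨α, hα, hrel, hbd⟩ := h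
  refine ⟨α, hα, hrel, fun i ↦ (hbd i).trans (by simp), fun i j hi _ ↦ ?_⟩
  have := hbd i
  omega

/-! ## Lemmas 1–2: relations give short lattice vectors -/

/-- **Core of Lemmas 1–2.** If `Σ aᵢγᵢ = 0` and `a ≠ 0` then, since `|⌊Kγᵢ⌋ − Kγᵢ| < 1`,
`|Σ aᵢ⌊Kγᵢ⌋| = |Σ aᵢ(⌊Kγᵢ⌋ − Kγᵢ)| < Σ |aᵢ|`, whence `‖(a, Σ aᵢ⌊Kγᵢ⌋)‖² < Σ aᵢ² + (Σ |aᵢ|)²`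
("upon using the upper bounds on `|αᵢ|` and the fact that `|γᵢ − γᵢ'| < K⁻¹`").
[cite: BestTrudgian2015, Lemma 1 (proof)] -/
theorem norm_sq_latticeVec_lt (K : ℤ) {γ : Fin n → ℝ} {a : Fin n → ℤ} (ha : a ≠ 0)
    (hrel : ∑ i, (a i : ℝ) * γ i = 0) :
    ‖latticeVec K γ a‖ ^ 2 < ∑ i, (a i : ℝ) ^ 2 + (∑ i, |(a i : ℝ)|) ^ 2 := by
  rw [norm_sq_latticeVec]
  -- rewrite the last coordinate through the relation
  have hK : ∑ i, (a i : ℝ) * ((K : ℝ) * γ i) = 0 := by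
    simp_rw [mul_left_comm _ (K : ℝ)]
    rw [← Finset.mul_sum, hrel, mul_zero]
  have hlast : ∑ i, (a i : ℝ) * (⌊(K : ℝ) * γ i⌋ : ℝ) =
      ∑ i, (a i : ℝ) * ((⌊(K : ℝ) * γ i⌋ : ℝ) - (K : ℝ) * γ i) := by
    simp_rw [mul_sub, Finset.sum_sub_distrib, hK, sub_zero]
  have habs : |∑ i, (a i : ℝ) * (⌊(K : ℝ) * γ i⌋ : ℝ)| < ∑ i, |(a i : ℝ)| := by
    rw [hlast]
    refine (Finset.abs_sum_le_sum_abs _ _).trans_lt ?_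
    obtain ⟨i₀, hi₀⟩ := Function.ne_iff.mp ha
    have hdef : ∀ i, |(⌊(K : ℝ) * γ i⌋ : ℝ) - (K : ℝ) * γ i| < 1 := fun i ↦ by
      rw [abs_sub_comm, abs_lt]
      constructor <;> linarith [Int.floor_le ((K : ℝ) * γ i), Int.lt_floor_add_one ((K : ℝ) * γ i)]
    refine Finset.sum_lt_sum (fun i _ ↦ ?_) ⟨i₀, Finset.mem_univ _, ?_⟩
    · rw [abs_mul]
      exact mul_le_of_le_one_right (abs_nonneg _) (hdef i).le
    · rw [abs_mul]
      have hpos : 0 < |(a i₀ : ℝ)| := abs_pos.mpr (by exact_mod_cast hi₀)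
      exact mul_lt_of_lt_one_right hpos (hdef i₀)
  have hnn : 0 ≤ ∑ i, |(a i : ℝ)| := Finset.sum_nonneg fun i _ ↦ abs_nonneg _
  have hsq : (∑ i, (a i : ℝ) * (⌊(K : ℝ) * γ i⌋ : ℝ)) ^ 2 < (∑ i, |(a i : ℝ)|) ^ 2 :=
    sq_lt_sq' (by linarith [(abs_lt.mp habs).1]) (abs_lt.mp habs).2
  linarith

/-- **Best–Trudgian 2015, Lemma 1.** If `S = {γ₁, …, γₙ}` is weakly `N_γ`-dependent then `L(K; S)`
contains a non-zero vector `v` with `|v|² < (n² + n)N_γ² + (2n + 2)N_γ + 2` (independently of `K`).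
[cite: BestTrudgian2015, Lemma 1] -/
theorem exists_short_of_weaklyNDependent {N : ℕ} (K : ℤ) {γ : Fin n → ℝ}
    (h : WeaklyNDependent N γ) :
    ∃ v ∈ lattice K γ, v ≠ 0 ∧
      ‖v‖ ^ 2 < ((n : ℝ) ^ 2 + n) * (N : ℝ) ^ 2 + (2 * n + 2) * N + 2 := by
  classical
  obtain ⟨α, hα, hrel, hbd, hone⟩ := h
  refine ⟨latticeVec K γ α, latticeVec_mem K γ α, latticeVec_ne_zero K γ hα, ?_⟩
  -- at most one coefficient has `|αᵢ| = N + 1`, all others have `|αᵢ| ≤ N`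
  set s : Finset (Fin n) := Finset.univ.filter fun i ↦ |α i| = N + 1 with hs
  have hcard : s.card ≤ 1 := Finset.card_le_one.mpr fun i hi j hj ↦
    hone i j (Finset.mem_filter.mp hi).2 (Finset.mem_filter.mp hj).2
  have hcardR : (s.card : ℝ) ≤ 1 := by exact_mod_cast hcard
  have hdich : ∀ i, |α i| = N + 1 ∨ |α i| ≤ N := fun i ↦ by
    rcases (hbd i).lt_or_eq with h | h
    · exact Or.inr (Int.lt_add_one_iff.mp h)
    · exact Or.inl h
  have hsq : ∀ i, (α i : ℝ) ^ 2 ≤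
      (N : ℝ) ^ 2 + (2 * N + 1) * (if |α i| = (N : ℤ) + 1 then (1 : ℝ) else 0) := by
    intro i
    rcases hdich i with h | h
    · rw [if_pos h]
      have : |(α i : ℝ)| = N + 1 := by exact_mod_cast h
      nlinarith [sq_abs (α i : ℝ)]
    · have : |(α i : ℝ)| ≤ N := by exact_mod_cast h
      have h0 : (0 : ℝ) ≤ (2 * N + 1) * (if |α i| = (N : ℤ) + 1 then (1 : ℝ) else 0) := by
        positivity
      nlinarith [sq_abs (α i : ℝ), abs_nonneg (α i : ℝ)]
  have habs : ∀ i, |(α i : ℝ)| ≤ (N : ℝ) + (if |α i| = (N : ℤ) + 1 then (1 : ℝ) else 0) := by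
    intro i
    rcases hdich i with h | h
    · rw [if_pos h]
      exact le_of_eq (by exact_mod_cast h)
    · have : |(α i : ℝ)| ≤ N := by exact_mod_cast h
      have h0 : (0 : ℝ) ≤ (if |α i| = (N : ℤ) + 1 then (1 : ℝ) else 0) := by positivity
      linarith
  have hind : ∑ i, (if |α i| = (N : ℤ) + 1 then (1 : ℝ) else 0) = s.card := by
    rw [Finset.sum_boole, hs]
  have h1 : ∑ i, (α i : ℝ) ^ 2 ≤ n * (N : ℝ) ^ 2 + (2 * N + 1) := by
    refine (Finset.sum_le_sum fun i _ ↦ hsq i).trans ?_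
    rw [Finset.sum_add_distrib, Finset.sum_const, Finset.card_univ, Fintype.card_fin,
      nsmul_eq_mul, ← Finset.mul_sum, hind]
    nlinarith
  have h2 : ∑ i, |(α i : ℝ)| ≤ n * (N : ℝ) + 1 := by
    refine (Finset.sum_le_sum fun i _ ↦ habs i).trans ?_
    rw [Finset.sum_add_distrib, Finset.sum_const, Finset.card_univ, Fintype.card_fin,
      nsmul_eq_mul, hind]
    linarith
  have h3 := norm_sq_latticeVec_lt K hα hrel
  have h4 : (∑ i, |(α i : ℝ)|) ^ 2 ≤ (n * (N : ℝ) + 1) ^ 2 :=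
    pow_le_pow_left₀ (Finset.sum_nonneg fun i _ ↦ abs_nonneg _) h2 2
  nlinarith

/-- **Best–Trudgian 2015, Lemma 2, in the form used by Theorem 3.** If `Σᵢ αᵢγᵢ = γ_t` with
integers `|αᵢ| ≤ N_γ` (a relation of type (2.5) on `S = {γ₁, …, γₙ, γ_t}`, coefficient of `γ_t`
equal to `−1`), then `L(K; S)` contains a non-zero `v` with `|v|² < (n² + n)N_γ² + 2nN_γ + 2`. The
printed hypothesis ("`S` is `N_γ`-dependent") is wider than what this bound and the proof of
Theorem 3 support; see the module docstring. [cite: BestTrudgian2015, Lemma 2] -/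
theorem exists_short_of_relation {N : ℕ} (K : ℤ) {γ : Fin n → ℝ} {γt : ℝ} {α : Fin n → ℤ}
    (hbd : ∀ i, |α i| ≤ N) (hrel : ∑ i, (α i : ℝ) * γ i = γt) :
    ∃ v ∈ lattice K (Fin.snoc γ γt : Fin (n + 1) → ℝ), v ≠ 0 ∧
      ‖v‖ ^ 2 < ((n : ℝ) ^ 2 + n) * (N : ℝ) ^ 2 + 2 * n * N + 2 := by
  set a : Fin (n + 1) → ℤ := Fin.snoc α (-1) with ha_def
  have ha : a ≠ 0 := by
    intro h
    have := congrFun h (Fin.last n)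
    simp [ha_def] at this
  have hrel' : ∑ i, (a i : ℝ) * (Fin.snoc γ γt : Fin (n + 1) → ℝ) i = 0 := by
    rw [Fin.sum_univ_castSucc]
    simp [ha_def, hrel]
  refine ⟨latticeVec K _ a, latticeVec_mem K _ a, latticeVec_ne_zero K _ ha, ?_⟩
  have h3 := norm_sq_latticeVec_lt K ha hrel'
  have hbdR : ∀ i, |(α i : ℝ)| ≤ N := fun i ↦ by exact_mod_cast hbd i
  have h1 : ∑ i, (a i : ℝ) ^ 2 ≤ n * (N : ℝ) ^ 2 + 1 := by
    rw [Fin.sum_univ_castSucc]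
    simp only [ha_def, Fin.snoc_castSucc, Fin.snoc_last, Int.cast_neg, Int.cast_one, even_two,
      Even.neg_pow, one_pow, add_le_add_iff_right]
    calc ∑ i : Fin n, (α i : ℝ) ^ 2 ≤ ∑ _i : Fin n, (N : ℝ) ^ 2 :=
          Finset.sum_le_sum fun i _ ↦ by nlinarith [sq_abs (α i : ℝ), abs_nonneg (α i : ℝ), hbdR i]
      _ = n * (N : ℝ) ^ 2 := by simp
  have h2 : ∑ i, |(a i : ℝ)| ≤ n * (N : ℝ) + 1 := by
    rw [Fin.sum_univ_castSucc]
    simp only [ha_def, Fin.snoc_castSucc, Fin.snoc_last, Int.cast_neg, Int.cast_one, abs_neg,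
      abs_one, add_le_add_iff_right]
    calc ∑ i : Fin n, |(α i : ℝ)| ≤ ∑ _i : Fin n, (N : ℝ) := Finset.sum_le_sum fun i _ ↦ hbdR i
      _ = n * (N : ℝ) := by simp
  have h4 : (∑ i, |(a i : ℝ)|) ^ 2 ≤ (n * (N : ℝ) + 1) ^ 2 :=
    pow_le_pow_left₀ (Finset.sum_nonneg fun i _ ↦ abs_nonneg _) h2 2
  nlinarith

end BestTrudgian

end Literature.NumberTheory.LFunctions

end
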